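import Summits.Ventures.PercRepro.C025ProfileRowReduction
import Summits.Ventures.PercRepro.ProfileTopLevel

/-!
# THE FIRST OPEN ROW AT RANK ≤ 4 — the explicit certificate, the double count, the rank-restricted reduction (night-3 g7)

`proofs/NIGHT3-G7-RANK4-CERTIFICATE.md`: for every matroid of rank ≤ 4, `(Π_{2,3})` — `3·W_3 ≥ Σ_{B : ρ(B) = 2, ρ(E∖B) ≥ 3} ρ(E∖B)` —
follows from an EXPLICIT weight function `w4 M B S` on the pairs `B ⊆ S` (`ρ(B) = 2`, `ρ(S) = 3`) satisfying, on every
SIMPLE rank-4 matroid, the two LOCAL inequalities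
  (Cap)  `Σ_{B ⊆ S, ρ(B) = 2} w4 M B S ≤ 3`  for every rank-3 set `S`,      (Dem)  `Σ_{S ⊇ B, ρ(S) = 3} w4 M B S ≥ ρ(E∖B)`  for every
  rank-2 set `B` with `ρ(E∖B) ≥ 3`
(the paper proves both by closure arguments in rank 4; the certificate is checked by machine on ≈ 5,000 rank-4 matroids).
This module types the rest: the rule `w4` (§0 of the paper), `crk` / `jB` (the complement rank and the line excess),
`price_two_three_eq` (`C(p+2,3)/C(p+2,2) = p/3`), the DOUBLE COUNT `profileIneq_two_three_of_cert` ((Cap) ∧ (Dem) ⟹ `(Π_{2,3})`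
on `M`), `profileIneq_of_eRank_lt` (a level above the rank is empty and every price is `0`), and the RANK-RESTRICTED
reduction `profileIneq_two_three_of_simple_rank_le` ((Π_{2,3}) for every matroid of rank ≤ R ⟸ the simple ones of rank ≤ R),
assembled in **`profileIneq_two_three_rank_le_four_of_cert`**: if `w4` satisfies (Cap) and (Dem) on every simple matroid of
rank 4, then `(Π_{2,3})` holds on every matroid of rank ≤ 4. What is NOT here: (Cap) and (Dem) themselves.
-/

open scoped Matroid

namespace PercRepro

open Set Finset ThmH

section RankFourCert

variable {α : Type} [DecidableEq α] (M : Matroid α) [M.Finite]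

/-- The rank of the complement of a finset, as a natural number. -/
noncomputable def crk (X : Finset α) : ℕ := (M.eRk ((gr M \ X : Finset α) : Set α)).toNat

/-- `j(B) = min(2, |cl B| − |B|)`: the points of the line of `B` outside `B`, capped at `2`. -/
noncomputable def jB (B : Finset α) : ℕ := min 2 ((clF M B).card - B.card)

/-- **The rank-4 certificate** (NIGHT3-G7-RANK4-CERTIFICATE.md §0), with `p = ρ(E∖B)`, `r = ρ(E∖S)`, `j = j(B)`, `e = |S ∖ B|`:
`e = 1`: `|B| ≥ 3 ↦ p/(r+1−j)`; `|B| = 2 ↦ p/(r+1)` (`j = 0`), `1` (`j = 1`), `3/2` or `1` (`j = 2`, by `r = p − 1` or not);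
`e = 2, |B| = 2`: `1/(p−1)` (`j = 1`, `r = p − 2`), `1/4, 1/6, 1/9` (`j = 2`, `p = 4`, `r = 2, 3, 4`); `0` otherwise, and `0`
whenever `p < 3`. -/
noncomputable def w4 (B S : Finset α) : ℚ :=
  let p := crk M B
  let r := crk M S
  let j := jB M B
  let e := (S \ B).card
  if p < 3 then 0
  else if e = 1 then
    (if 3 ≤ B.card then (p : ℚ) / ((r : ℚ) + 1 - (j : ℚ))
     else if j = 0 then (p : ℚ) / ((r : ℚ) + 1)
     else if j = 1 then 1
     else if r + 1 = p then 3 / 2 else 1)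
  else if e = 2 ∧ B.card = 2 then
    (if j = 1 ∧ r + 2 = p then 1 / ((p : ℚ) - 1)
     else if j = 2 ∧ p = 4 then (if r = 2 then 1 / 4 else if r = 3 then 1 / 6 else if r = 4 then 1 / 9 else 0)
     else 0)
  else 0

variable {M}

/-- `C(p+2,3)/C(p+2,2) = p/3`. -/
theorem choose_ratio_two_three (p : ℕ) : (Nat.choose (p + 2) 3 : ℚ) / (Nat.choose (p + 2) 2 : ℚ) = (p : ℚ) / 3 := by
  have h := Nat.choose_succ_right_eq (p + 2) 2   -- C(p+2,3)·3 = C(p+2,2)·(p+2−2)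
  rw [show p + 2 - 2 = p by omega] at h
  have hpos : (0 : ℚ) < Nat.choose (p + 2) 2 := by exact_mod_cast Nat.choose_pos (by omega)
  rw [div_eq_div_iff hpos.ne' (by norm_num : (3 : ℚ) ≠ 0)]
  have h' : ((Nat.choose (p + 2) 3 * 3 : ℕ) : ℚ) = ((Nat.choose (p + 2) 2 * p : ℕ) : ℚ) := by rw [h]
  push_cast at h'
  linarith

/-- The price at `(2, 3)` is `[3 ≤ ρ(E∖B)] · ρ(E∖B)/3`. -/
theorem price_two_three_eq (B : Finset α) :
    Profile.price M 2 3 B = if 3 ≤ crk M B then (crk M B : ℚ) / 3 else 0 := by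
  have hfin : M.eRk ((gr M \ B : Finset α) : Set α) ≠ ⊤ := by
    rw [← lt_top_iff_ne_top]; exact (M.isRkFinite_set _).eRk_lt_top
  unfold Profile.price crk
  rw [← ENat.coe_toNat hfin, ENat.toNat_coe]
  by_cases h : 3 ≤ (M.eRk ((gr M \ B : Finset α) : Set α)).toNat
  · rw [if_pos (by exact_mod_cast h), if_pos h, choose_ratio_two_three]
  · rw [if_neg (by exact_mod_cast h), if_neg h]

/-- **The double count**: if `w4` satisfies (Cap) and (Dem) on `M` then `(Π_{2,3})` holds on `M`. -/
theorem profileIneq_two_three_of_cert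
    (hCap : ∀ S ∈ Shadow.levelSet M 3, ∑ B ∈ (Profile.Rq M 2).filter (fun B => B ⊆ S), w4 M B S ≤ 3)
    (hDem : ∀ B ∈ Profile.Rq M 2, 3 ≤ crk M B →
      (crk M B : ℚ) ≤ ∑ S ∈ (Shadow.levelSet M 3).filter (fun S => B ⊆ S), w4 M B S)
    (hw : ∀ B S, 0 ≤ w4 M B S) : Profile.ProfileIneq M 2 3 := by
  unfold Profile.ProfileIneq
  have hswap : ∑ B ∈ Profile.Rq M 2, ∑ S ∈ (Shadow.levelSet M 3).filter (fun S => B ⊆ S), w4 M B S =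
      ∑ S ∈ Shadow.levelSet M 3, ∑ B ∈ (Profile.Rq M 2).filter (fun B => B ⊆ S), w4 M B S := by
    apply Finset.sum_comm'
    intro B S
    simp only [Finset.mem_filter]
    tauto
  have h1 : ∑ B ∈ Profile.Rq M 2, Profile.price M 2 3 B ≤
      ∑ B ∈ Profile.Rq M 2, (1 / 3 : ℚ) * ∑ S ∈ (Shadow.levelSet M 3).filter (fun S => B ⊆ S), w4 M B S := by
    apply Finset.sum_le_sum
    intro B hB
    rw [price_two_three_eq]
    split_ifs with h
    · have := hDem B hB h
      linarith
    · exact mul_nonneg (by norm_num) (Finset.sum_nonneg (fun S _ => hw B S))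
  have h2 : ∑ S ∈ Shadow.levelSet M 3, ∑ B ∈ (Profile.Rq M 2).filter (fun B => B ⊆ S), w4 M B S ≤
      ∑ _S ∈ Shadow.levelSet M 3, (3 : ℚ) := Finset.sum_le_sum hCap
  rw [Finset.sum_const, nsmul_eq_mul] at h2
  rw [← Finset.mul_sum, hswap] at h1
  linarith

/-- A level above the rank is empty and every price there is `0`: `(Π_{q,u})` holds when `ρ(E) < u`. -/
theorem profileIneq_of_eRank_lt {q u : ℕ} (hu : M.eRank < (u : ℕ∞)) : Profile.ProfileIneq M q u := by
  unfold Profile.ProfileIneq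
  have hprice : ∀ B ∈ Profile.Rq M q, Profile.price M q u B = 0 := by
    intro B _
    unfold Profile.price
    rw [if_neg]
    intro h
    exact absurd (lt_of_le_of_lt (h.trans (M.eRk_le_eRank _)) hu) (lt_irrefl _)
  rw [Finset.sum_eq_zero hprice]
  exact Nat.cast_nonneg _

omit [DecidableEq α] [M.Finite] in
/-- The rank of `M ＼ {e}` is at most the rank of `M`. -/
theorem eRank_delete_singleton_le (e : α) : (M ＼ ({e} : Set α)).eRank ≤ M.eRank := by
  rw [Matroid.delete_eq_restrict, Matroid.eRank_restrict]
  exact M.eRk_le_eRank _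

omit [DecidableEq α] [M.Finite] in
/-- The rank of `M ／ {e}` is at most the rank of `M` (`e` a non-loop: it is one less). -/
theorem eRank_contract_singleton_le {e : α} (he : M.Indep {e}) : (M ／ ({e} : Set α)).eRank ≤ M.eRank := by
  have hsub : M.E \ {e} ⊆ M.E \ {e} := subset_refl _
  have h := contract_singleton_eRk_add_one he hsub
  have heE : e ∈ M.E := he.subset_ground (Set.mem_singleton e)
  have hins : insert e (M.E \ {e}) = M.E := by
    rw [Set.insert_sdiff_singleton, Set.insert_eq_of_mem heE]
  rw [hins, ← M.eRank_def] at h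
  rw [Matroid.eRank_def, Matroid.contract_ground]
  calc (M ／ ({e} : Set α)).eRk (M.E \ {e}) ≤ (M ／ ({e} : Set α)).eRk (M.E \ {e}) + 1 := le_self_add
    _ = M.eRank := h

/-- **The rank-restricted reduction of the row `(2,3)` to simple matroids**: if `(Π_{2,3})` holds for every simple matroid of
rank `≤ R`, it holds for every matroid of rank `≤ R`. -/
theorem profileIneq_two_three_of_simple_rank_le (R : ℕ)
    (hS : ∀ (N : Matroid α) [N.Finite], N.eRank ≤ (R : ℕ∞) → (∀ T ⊆ N.E, T.encard ≤ 2 → N.Indep T) →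
      Profile.ProfileIneq N 2 3)
    (M : Matroid α) [M.Finite] (hM : M.eRank ≤ (R : ℕ∞)) : Profile.ProfileIneq M 2 3 := by
  suffices h : ∀ n : ℕ, ∀ (N : Matroid α) [N.Finite], (gr N).card = n → N.eRank ≤ (R : ℕ∞) →
      Profile.ProfileIneq N 2 3 from h _ M rfl hM
  intro n
  induction n using Nat.strong_induction_on with
  | _ n ih =>
  intro N _ hN hR
  by_cases hloop : ∃ ℓ, N.IsLoop ℓ
  · obtain ⟨ℓ, hℓ⟩ := hloop
    have hℓE : ℓ ∈ gr N := by rw [← Finset.mem_coe, coe_gr]; exact hℓ.mem_ground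
    apply profileIneq_of_delete_isLoop hℓ
    apply ih ((gr N).erase ℓ).card _ (N ＼ ({ℓ} : Set α)) (by rw [gr_delete_singleton''])
      ((eRank_delete_singleton_le ℓ).trans hR)
    rw [← hN]; exact Finset.card_erase_lt_of_mem hℓE
  · have hl : ∀ x ∈ N.E, N.IsNonloop x := fun x hx => N.isNonloop_of_not_isLoop hx (fun h => hloop ⟨x, h⟩)
    by_cases hpar : ∃ e f, f ∈ N.E ∧ f ≠ e ∧ e ∈ N.closure {f}
    · obtain ⟨e, f, hfE, hfe, hef⟩ := hpar
      have heE : e ∈ gr N := by rw [← Finset.mem_coe, coe_gr]; exact N.closure_subset_ground _ hef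
      have hlt : ((gr N).erase e).card < n := by rw [← hN]; exact Finset.card_erase_lt_of_mem heE
      apply profileIneq_of_delete_parallel_gen hl hfE hfe hef (by omega : 1 ≤ 2)
      · exact ih _ hlt (N ＼ ({e} : Set α)) (by rw [gr_delete_singleton'']) ((eRank_delete_singleton_le e).trans hR)
      · exact profileIneq_one_all (N ／ ({e} : Set α)) 2 (by omega)
    · push Not at hpar
      exact hS N hR (simple_of_no_loop_no_parallel hl hpar)

/-- **`(Π_{2,3})` for every matroid of rank `≤ 4`, given the certificate's two local inequalities on every simple matroid
of rank `4`.** The simple matroids of rank `3` are the top level (`profileIneq_top`), those of rank `≤ 2` have an empty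
level `3`. -/
theorem profileIneq_two_three_rank_le_four_of_cert
    (hCert : ∀ (N : Matroid α) [N.Finite], N.eRank = (4 : ℕ∞) → (∀ T ⊆ N.E, T.encard ≤ 2 → N.Indep T) →
      (∀ S ∈ Shadow.levelSet N 3, ∑ B ∈ (Profile.Rq N 2).filter (fun B => B ⊆ S), w4 N B S ≤ 3) ∧
      (∀ B ∈ Profile.Rq N 2, 3 ≤ crk N B →
        (crk N B : ℚ) ≤ ∑ S ∈ (Shadow.levelSet N 3).filter (fun S => B ⊆ S), w4 N B S))
    (hw : ∀ (N : Matroid α) [N.Finite] (B S : Finset α), 0 ≤ w4 N B S)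
    (M : Matroid α) [M.Finite] (hM : M.eRank ≤ (4 : ℕ∞)) : Profile.ProfileIneq M 2 3 := by
  apply profileIneq_two_three_of_simple_rank_le 4 _ M hM
  intro N _ hR hsimple
  have hRtop : N.eRank ≠ ⊤ := N.eRank_ne_top_iff.2 inferInstance
  obtain ⟨R, hRe⟩ := ENat.ne_top_iff_exists.1 hRtop
  have hR4 : R ≤ 4 := by rw [← hRe] at hR; exact_mod_cast hR
  rcases lt_or_eq_of_le hR4 with hlt | heq
  · rcases lt_or_eq_of_le (Nat.lt_succ_iff.1 hlt) with hlt3 | heq3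
    · -- rank ≤ 2: the level 3 is empty
      apply profileIneq_of_eRank_lt
      rw [← hRe]; exact_mod_cast hlt3
    · -- rank 3: the top level
      exact Profile.profileIneq_top (R := 3) (by rw [← hRe, heq3]) 2
  · subst heq
    obtain ⟨hCap, hDem⟩ := hCert N hRe.symm hsimple
    exact profileIneq_two_three_of_cert hCap hDem (hw N)

end RankFourCert

end PercRepro
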